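import Summits.AtomisticToContinuum.BoseEinsteinCondensation.Theorems.BECConjugateDominationHardCoreExtensionTruncationReduction
import Summits.AtomisticToContinuum.BoseEinsteinCondensation.Theorems.BECConjugateDominationHardCoreExtensionBoundedPositiveMinimiser
import Literature.MathematicalPhysics.QuantumManyBody.PeriodicFormCoreTrigPoly
import HarnessLib

/-!
# The maximal-form bound for BOUNDED potentials: stub `stub_maxFormBoundBounded` of line
# `third-law-current-floor` for crux `BECConjugateDomination.HardCoreExtension` (stmt-AtomisticToContinuum-11786)

For a repulsive finite-range pair potential `v` with `v ≤ M < ⊤`, every particle number `N`, every torus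
side `L > 0` and every unit `η ∈ L²((ℝ/ℤ)^{3N})` (Haar probability measure, Mathlib's `AddCircleMulti`
convention, as in `PeriodicFormDomain.lean`) whose Fourier coefficients are invariant under the particle
permutations `n ↦ n ∘ (σ × id)`, the periodic ground-state energy is bounded by the MAXIMAL-form energy
of `η`:

  `periodicGroundStateEnergy v N L ≤ ∑ₙ (∑ₚ (2πnₚ/L)²) |⟪eₙ, η⟫|² + ∫ (W ∘ fromUnitTorusN L) |η|²`,
  `W = periodicInteraction v L = ∑_{i<j} v^per(xᵢ - xⱼ)`.

This is the bounded special case of the sibling cruxes' `stub_maxFormBound` (stmt-AtomisticToContinuum-12057,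
all admissible `v`, hard cores included, which needs capacity theory); for bounded `v` only Fourier
truncation is needed:

* the box truncations `P_K = ∑_{n ∈ [-K,K]^{3N}} ⟪eₙ, η⟫ eₙ` are Bose-symmetric trigonometric polynomials,
  hence embedded core functions, and `E₀ · ‖P_K‖² ≤ Q_v(P_K)`
  (`periodicGroundStateEnergy_mul_le_maxForm_sum_smul` of `PeriodicFormCoreTrigPoly.lean`);
* the kinetic part of `Q_v(P_K)` is a truncation of that of `η` (orthonormality);
* the potential part is `‖·‖_{L²}`-stable for a bounded weight (`lintegral_weight_sq_le_add`:
  `∫ W|f|² ≤ ∫ W|g|² + B (2‖g‖ ‖f-g‖ + ‖f-g‖²)` for `W ≤ B`, Cauchy–Schwarz), and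
  `W ∘ fromUnitTorusN L ≤ N² C < ⊤` by `exists_periodizedPotential_le` / `periodicInteraction_le_of_bound`;
* `P_K → η` in `L²` (`mFourierBasis.hasSum_repr`, the boxes are cofinal among finite sets), so
  `ofReal ‖P_K‖² → 1` and the error term tends to `0`; pass to the limit in `ℝ≥0∞`.

References: [ReedSimonIV1978] M. Reed, B. Simon, *Methods of Modern Mathematical Physics IV*,
Thm. XIII.64; B. Simon, *Maximal and minimal Schrödinger forms*, J. Operator Theory 1 (1979) 37–47;
[LSSY2005] App. A.
-/

noncomputable section

namespace Summit.AtomisticToContinuum.BoseEinsteinCondensation.Cruxes.HardCoreExtension.ThirdLawCurrentFloor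

open MeasureTheory Filter UnitAddTorus
open scoped ENNReal NNReal BigOperators Topology InnerProductSpace
open Literature.MathematicalPhysics.QuantumManyBody.BoseGas

-- The measure on `ℝ/ℤ` is the Haar PROBABILITY measure, as in `PeriodicFormDomain.lean`.
attribute [local instance] Literature.MathematicalPhysics.QuantumManyBody.BoseGas.formDomain_measureSpace
  Literature.MathematicalPhysics.QuantumManyBody.BoseGas.formDomain_isProbabilityMeasure
  Literature.MathematicalPhysics.QuantumManyBody.BoseGas.formDomain_isProbabilityMeasure_pi

/-! ### Stability of a bounded weighted `L²` mass -/

section WeightedStability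

variable {α : Type*} [MeasurableSpace α] {μ : Measure α}

/-- The `L²` norm as a `lintegral`: `‖f‖ₑ = (∫⁻ ‖f‖₊²)^{1/2}`. [folklore] -/
theorem enorm_Lp_two_eq_rpow (f : Lp ℂ 2 μ) :
    ‖f‖ₑ = (∫⁻ x, (‖f x‖₊ : ℝ≥0∞) ^ (2 : ℝ) ∂μ) ^ (1 / (2 : ℝ)) := by
  rw [Lp.enorm_def, eLpNorm_eq_lintegral_rpow_enorm_toReal two_ne_zero ENNReal.ofNat_ne_top,
    ENNReal.toReal_ofNat]
  simp only [enorm_eq_nnnorm]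

/-- `‖f‖ₑ² = ∫⁻ ‖f‖₊²` in `L²`. [folklore] -/
theorem enorm_Lp_two_sq (f : Lp ℂ 2 μ) : ‖f‖ₑ ^ 2 = ∫⁻ x, (‖f x‖₊ : ℝ≥0∞) ^ 2 ∂μ := by
  rw [enorm_Lp_two_eq_rpow]
  conv_lhs =>
    rw [← ENNReal.rpow_two, ← ENNReal.rpow_mul, one_div_mul_cancel two_ne_zero, ENNReal.rpow_one]
  simp only [ENNReal.rpow_two]

/-- Cauchy–Schwarz in `L²`, `lintegral` form: `∫⁻ ‖f‖₊‖g‖₊ ≤ ‖f‖ₑ‖g‖ₑ`. [folklore] -/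
theorem lintegral_nnnorm_mul_nnnorm_le (f g : Lp ℂ 2 μ) :
    ∫⁻ x, (‖f x‖₊ : ℝ≥0∞) * ‖g x‖₊ ∂μ ≤ ‖f‖ₑ * ‖g‖ₑ := by
  rw [enorm_Lp_two_eq_rpow, enorm_Lp_two_eq_rpow]
  exact ENNReal.lintegral_mul_le_Lp_mul_Lq μ Real.HolderConjugate.two_two
    (Lp.aestronglyMeasurable f).aemeasurable.nnnorm.coe_nnreal_ennreal
    (Lp.aestronglyMeasurable g).aemeasurable.nnnorm.coe_nnreal_ennreal

/-- **Stability of a bounded weighted `L²` mass.** For a weight `W ≤ B` and `f, g ∈ L²`,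
`∫⁻ W‖f‖² ≤ ∫⁻ W‖g‖² + B (2‖g‖ ‖f - g‖ + ‖f - g‖²)`. [folklore] -/
theorem lintegral_weight_sq_le_add {W : α → ℝ≥0∞} (hWm : AEMeasurable W μ) {B : ℝ≥0∞}
    (hW : ∀ x, W x ≤ B) (f g : Lp ℂ 2 μ) :
    ∫⁻ x, W x * (‖f x‖₊ : ℝ≥0∞) ^ 2 ∂μ ≤
      ∫⁻ x, W x * (‖g x‖₊ : ℝ≥0∞) ^ 2 ∂μ + B * (2 * (‖g‖ₑ * ‖f - g‖ₑ) + ‖f - g‖ₑ ^ 2) := by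
  have hg : AEMeasurable (fun x => (‖g x‖₊ : ℝ≥0∞)) μ :=
    (Lp.aestronglyMeasurable g).aemeasurable.nnnorm.coe_nnreal_ennreal
  have hh : AEMeasurable (fun x => (‖(f - g) x‖₊ : ℝ≥0∞)) μ :=
    (Lp.aestronglyMeasurable (f - g)).aemeasurable.nnnorm.coe_nnreal_ennreal
  have hpt : ∀ᵐ x ∂μ, W x * (‖f x‖₊ : ℝ≥0∞) ^ 2 ≤
      W x * (‖g x‖₊ : ℝ≥0∞) ^ 2 +
        B * (2 * ((‖g x‖₊ : ℝ≥0∞) * ‖(f - g) x‖₊) + (‖(f - g) x‖₊ : ℝ≥0∞) ^ 2) := by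
    filter_upwards [Lp.coeFn_sub f g] with x hx
    have h1 : (‖f x‖₊ : ℝ≥0∞) ≤ ‖g x‖₊ + ‖(f - g) x‖₊ := by
      rw [hx, Pi.sub_apply]
      exact_mod_cast nnnorm_le_insert' (f x) (g x)
    calc W x * (‖f x‖₊ : ℝ≥0∞) ^ 2 ≤ W x * ((‖g x‖₊ : ℝ≥0∞) + ‖(f - g) x‖₊) ^ 2 := by gcongr
      _ = W x * (‖g x‖₊ : ℝ≥0∞) ^ 2 +
          W x * (2 * ((‖g x‖₊ : ℝ≥0∞) * ‖(f - g) x‖₊) + (‖(f - g) x‖₊ : ℝ≥0∞) ^ 2) := by ring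
      _ ≤ _ := by gcongr; exact hW x
  calc ∫⁻ x, W x * (‖f x‖₊ : ℝ≥0∞) ^ 2 ∂μ
      ≤ ∫⁻ x, (W x * (‖g x‖₊ : ℝ≥0∞) ^ 2 +
          B * (2 * ((‖g x‖₊ : ℝ≥0∞) * ‖(f - g) x‖₊) + (‖(f - g) x‖₊ : ℝ≥0∞) ^ 2)) ∂μ :=
        lintegral_mono_ae hpt
    _ = ∫⁻ x, W x * (‖g x‖₊ : ℝ≥0∞) ^ 2 ∂μ +
          B * (2 * ∫⁻ x, (‖g x‖₊ : ℝ≥0∞) * ‖(f - g) x‖₊ ∂μ + ∫⁻ x, (‖(f - g) x‖₊ : ℝ≥0∞) ^ 2 ∂μ) := by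
        have hm1 : AEMeasurable (fun x => W x * (‖g x‖₊ : ℝ≥0∞) ^ 2) μ := hWm.mul (hg.pow_const 2)
        have hm2 : AEMeasurable (fun x => (‖g x‖₊ : ℝ≥0∞) * ‖(f - g) x‖₊) μ := hg.mul hh
        have hm3 : AEMeasurable (fun x => (‖(f - g) x‖₊ : ℝ≥0∞) ^ 2) μ := hh.pow_const 2
        have hm4 : AEMeasurable
            (fun x => 2 * ((‖g x‖₊ : ℝ≥0∞) * ‖(f - g) x‖₊) + (‖(f - g) x‖₊ : ℝ≥0∞) ^ 2) μ :=
          (hm2.const_mul 2).add hm3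
        rw [lintegral_add_left' hm1, lintegral_const_mul'' _ hm4, lintegral_add_right' _ hm3,
          lintegral_const_mul'' _ hm2]
    _ ≤ _ := by
        gcongr
        · exact lintegral_nnnorm_mul_nnnorm_le g (f - g)
        · exact (enorm_Lp_two_sq (f - g)).ge

end WeightedStability

/-! ### The maximal-form bound by Fourier truncation -/

/-- **The maximal-form bound for bounded potentials (`MaxFormBound`, bounded case).** For a repulsive
finite-range pair potential `v` that is BOUNDED (`v ≤ M < ⊤`), every `N`, every `L > 0` and every unit
class `η ∈ L²((ℝ/ℤ)^{3N})` that is Bose-symmetric in momentum space,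
`E₀(v; N, L) ≤ Q_v(η) = ∑ₙ (2πn/L)² |⟪eₙ, η⟫|² + ∫ (W ∘ fromUnitTorusN L) |η|²`, `W = ∑_{i<j} v^per(xᵢ - xⱼ)`:
the bottom of the `C¹` periodic Bose core is the bottom of the maximal form. Proof by Fourier truncation:
the box truncations `P_K = ∑_{|nₚ| ≤ K} ⟪eₙ, η⟫ eₙ` are Bose-symmetric trigonometric polynomials, so
`E₀ ‖P_K‖² ≤ Q_v(P_K)` (`periodicGroundStateEnergy_mul_le_maxForm_sum_smul`); truncation only removes
kinetic terms, the potential term is `‖·‖₂`-continuous because `W ≤ N² sup v^per < ⊤`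
(`exists_periodizedPotential_le`, `lintegral_weight_sq_le_add`), and `P_K → η` in `L²` (Hilbert basis
`mFourierBasis`, the boxes being cofinal among finite sets). [cite: ReedSimonIV1978, Thm. XIII.64] -/
theorem stub_maxFormBoundBounded :
    ∀ v : ℝ → ℝ≥0∞, IsRepulsiveFiniteRange v → (∃ M : ℝ≥0∞, M ≠ ⊤ ∧ ∀ r, v r ≤ M) →
      ∀ (N : ℕ) (L : ℝ), 0 < L →
      ∀ η : Lp ℂ 2 (volume : Measure (UnitAddTorus (Fin N × Fin 3))), ‖η‖ = 1 →
        (∀ (σ : Equiv.Perm (Fin N)) (n : Fin N × Fin 3 → ℤ),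
          ⟪(mFourierLp 2 (fun p : Fin N × Fin 3 => n (σ p.1, p.2)) :
              Lp ℂ 2 (volume : Measure (UnitAddTorus (Fin N × Fin 3)))), η⟫_ℂ =
            ⟪(mFourierLp 2 n : Lp ℂ 2 (volume : Measure (UnitAddTorus (Fin N × Fin 3)))), η⟫_ℂ) →
        periodicGroundStateEnergy v N L ≤
          ∑' n : Fin N × Fin 3 → ℤ, ENNReal.ofReal (∑ p, (2 * Real.pi * (n p : ℝ) / L) ^ 2) *
              (‖⟪(mFourierLp 2 n : Lp ℂ 2 (volume : Measure (UnitAddTorus (Fin N × Fin 3)))), η⟫_ℂ‖₊ :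
                ℝ≥0∞) ^ 2 +
            ∫⁻ t, periodicInteraction v L (fromUnitTorusN L t) *
              (‖(η : UnitAddTorus (Fin N × Fin 3) → ℂ) t‖₊ : ℝ≥0∞) ^ 2 := by
  intro v hv hM N L hL η hη hsymm
  classical
  -- the transported weight `W = (∑_{i<j} v^per(xᵢ - xⱼ)) ∘ fromUnitTorusN L` is bounded by `B = N² C < ⊤`
  obtain ⟨C, hC⟩ := exists_periodizedPotential_le hv hM hL
  set W : UnitAddTorus (Fin N × Fin 3) → ℝ≥0∞ := fun t => periodicInteraction v L (fromUnitTorusN L t)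
  have hWm : Measurable W := (measurable_periodicInteraction hv.1 L).comp (measurable_fromUnitTorusN L)
  set B : ℝ≥0∞ := ((N * N : ℕ) : ℝ≥0∞) * (C : ℝ≥0∞)
  have hWB : ∀ t, W t ≤ B := fun t => periodicInteraction_le_of_bound (fun x => hC x) _
  have hBtop : B ≠ ⊤ := ENNReal.mul_ne_top (ENNReal.natCast_ne_top _) ENNReal.coe_ne_top
  -- the two halves of the maximal form of `η`
  set KIN : ℝ≥0∞ := ∑' n : Fin N × Fin 3 → ℤ, ENNReal.ofReal (∑ p, (2 * Real.pi * (n p : ℝ) / L) ^ 2) *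
    (‖⟪(mFourierLp 2 n : Lp ℂ 2 (volume : Measure (UnitAddTorus (Fin N × Fin 3)))), η⟫_ℂ‖₊ : ℝ≥0∞) ^ 2
  set POT : ℝ≥0∞ := ∫⁻ t, W t * (‖(η : UnitAddTorus (Fin N × Fin 3) → ℂ) t‖₊ : ℝ≥0∞) ^ 2
  change periodicGroundStateEnergy v N L ≤ KIN + POT
  -- Fourier coefficients, boxes of frequencies, truncations `P K = ∑_{n ∈ S K} a n • e_n`
  set a : (Fin N × Fin 3 → ℤ) → ℂ := fun n =>
    ⟪(mFourierLp 2 n : Lp ℂ 2 (volume : Measure (UnitAddTorus (Fin N × Fin 3)))), η⟫_ℂ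
  set S : ℕ → Finset (Fin N × Fin 3 → ℤ) := fun K => Fintype.piFinset fun _ => Finset.Icc (-(K : ℤ)) K
    with hSdef
  set P : ℕ → Lp ℂ 2 (volume : Measure (UnitAddTorus (Fin N × Fin 3))) := fun K =>
    ∑ n ∈ S K, a n • (mFourierLp 2 n : Lp ℂ 2 (volume : Measure (UnitAddTorus (Fin N × Fin 3)))) with hPdef
  have hS : ∀ (K : ℕ) (σ : Equiv.Perm (Fin N)), ∀ n ∈ S K,
      (fun p : Fin N × Fin 3 => n (σ p.1, p.2)) ∈ S K := by
    intro K σ n hn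
    simp only [hSdef, Fintype.mem_piFinset] at hn ⊢
    exact fun p => hn (σ p.1, p.2)
  have ha : ∀ (σ : Equiv.Perm (Fin N)) (n : Fin N × Fin 3 → ℤ), a (fun p => n (σ p.1, p.2)) = a n :=
    fun σ n => hsymm σ n
  -- the core variational principle for the Bose-symmetric trigonometric polynomials `P K`
  have hcore : ∀ K, periodicGroundStateEnergy v N L * ENNReal.ofReal (‖P K‖ ^ 2) ≤
      ∑' n : Fin N × Fin 3 → ℤ, ENNReal.ofReal (∑ p, (2 * Real.pi * (n p : ℝ) / L) ^ 2) *
          (‖⟪(mFourierLp 2 n : Lp ℂ 2 (volume : Measure (UnitAddTorus (Fin N × Fin 3)))), P K⟫_ℂ‖₊ :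
            ℝ≥0∞) ^ 2 +
        ∫⁻ t, W t * (‖(P K : UnitAddTorus (Fin N × Fin 3) → ℂ) t‖₊ : ℝ≥0∞) ^ 2 := fun K =>
    periodicGroundStateEnergy_mul_le_maxForm_sum_smul hL hv.1 (hS K) ha
  -- kinetic energy: Fourier truncation only removes terms
  have hkin : ∀ K, ∑' n : Fin N × Fin 3 → ℤ, ENNReal.ofReal (∑ p, (2 * Real.pi * (n p : ℝ) / L) ^ 2) *
        (‖⟪(mFourierLp 2 n : Lp ℂ 2 (volume : Measure (UnitAddTorus (Fin N × Fin 3)))), P K⟫_ℂ‖₊ :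
          ℝ≥0∞) ^ 2 ≤ KIN := fun K => by
    refine ENNReal.tsum_le_tsum fun n => ?_
    simp only [hPdef]
    rw [Literature.Analysis.FunctionSpaces.HaarTorus.inner_mFourierLp_sum_smul]
    split_ifs
    · exact le_rfl
    · simp
  -- potential energy: stability under the bounded weight
  have hpot : ∀ K, ∫⁻ t, W t * (‖(P K : UnitAddTorus (Fin N × Fin 3) → ℂ) t‖₊ : ℝ≥0∞) ^ 2 ≤
      POT + B * (2 * (‖η‖ₑ * ‖P K - η‖ₑ) + ‖P K - η‖ₑ ^ 2) := fun K =>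
    lintegral_weight_sq_le_add hWm.aemeasurable hWB (P K) η
  -- `P K → η` in `L²`: the Fourier series of `η` along the (cofinal) boxes
  have hsum : HasSum (fun n : Fin N × Fin 3 → ℤ =>
      a n • (mFourierLp 2 n : Lp ℂ 2 (volume : Measure (UnitAddTorus (Fin N × Fin 3))))) η := by
    have h := mFourierBasis.hasSum_repr η
    simp only [HilbertBasis.repr_apply_apply, coe_mFourierBasis] at h
    exact h
  have hSmono : Monotone S := fun K K' hKK' =>
    Fintype.piFinset_subset _ _ fun _ => Finset.Icc_subset_Icc (by omega) (by omega)
  have hScov : ∀ n : Fin N × Fin 3 → ℤ, ∃ K, n ∈ S K := fun n => by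
    obtain ⟨R, hR⟩ := Literature.Analysis.FunctionSpaces.HaarTorus.exists_subset_box ({n} : Finset _)
    exact ⟨R, hR (Finset.mem_singleton_self n)⟩
  have hPlim : Tendsto P atTop (𝓝 η) := hsum.comp (tendsto_atTop_finset_of_monotone hSmono hScov)
  have hnorm : Tendsto (fun K => ENNReal.ofReal (‖P K‖ ^ 2)) atTop (𝓝 1) := by
    have h := ENNReal.tendsto_ofReal (hPlim.norm.pow 2)
    rwa [hη, one_pow, ENNReal.ofReal_one] at h
  have hdist : Tendsto (fun K => ‖P K - η‖ₑ) atTop (𝓝 0) := by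
    have h := ENNReal.tendsto_ofReal (tendsto_iff_norm_sub_tendsto_zero.1 hPlim)
    simp only [ENNReal.ofReal_zero, ofReal_norm] at h
    exact h
  have herr : Tendsto (fun K => B * (2 * (‖η‖ₑ * ‖P K - η‖ₑ) + ‖P K - η‖ₑ ^ 2)) atTop (𝓝 0) := by
    have h1 : Tendsto (fun K => ‖η‖ₑ * ‖P K - η‖ₑ) atTop (𝓝 0) := by
      have h := ENNReal.Tendsto.const_mul hdist (Or.inr enorm_ne_top) (a := ‖η‖ₑ)
      rwa [mul_zero] at h
    have h2 : Tendsto (fun K => ‖P K - η‖ₑ ^ 2) atTop (𝓝 0) := by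
      have h := ((ENNReal.continuous_pow 2).tendsto 0).comp hdist
      rwa [zero_pow two_ne_zero] at h
    have h3 : Tendsto (fun K => 2 * (‖η‖ₑ * ‖P K - η‖ₑ) + ‖P K - η‖ₑ ^ 2) atTop (𝓝 0) := by
      have h := (ENNReal.Tendsto.const_mul h1 (Or.inr ENNReal.ofNat_ne_top) (a := 2)).add h2
      rwa [mul_zero, add_zero] at h
    have h := ENNReal.Tendsto.const_mul h3 (Or.inr hBtop) (a := B)
    rwa [mul_zero] at h
  -- pass to the limit in `E₀ ‖P K‖² ≤ KIN + POT + err K`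
  have hle : ∀ K, periodicGroundStateEnergy v N L * ENNReal.ofReal (‖P K‖ ^ 2) ≤
      KIN + POT + B * (2 * (‖η‖ₑ * ‖P K - η‖ₑ) + ‖P K - η‖ₑ ^ 2) := fun K =>
    (hcore K).trans ((add_le_add (hkin K) (hpot K)).trans_eq (add_assoc _ _ _).symm)
  have hlim1 : Tendsto (fun K => periodicGroundStateEnergy v N L * ENNReal.ofReal (‖P K‖ ^ 2)) atTop
      (𝓝 (periodicGroundStateEnergy v N L * 1)) :=
    ENNReal.Tendsto.const_mul hnorm (Or.inl one_ne_zero)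
  have hlim2 : Tendsto (fun K => KIN + POT + B * (2 * (‖η‖ₑ * ‖P K - η‖ₑ) + ‖P K - η‖ₑ ^ 2)) atTop
      (𝓝 (KIN + POT + 0)) :=
    tendsto_const_nhds.add herr
  have h := le_of_tendsto_of_tendsto' hlim1 hlim2 hle
  rwa [mul_one, add_zero] at h

end Summit.AtomisticToContinuum.BoseEinsteinCondensation.Cruxes.HardCoreExtension.ThirdLawCurrentFloor

end
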